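import Mathlib.Analysis.InnerProductSpace.Calculus
import Mathlib.Analysis.Calculus.MeanValue
import Mathlib.Analysis.Calculus.Deriv.MeanValue
import Literature.MathematicalPhysics.QuantumFieldTheory.Balaban1983to89.B10Eq22Rescaling
import Summits.QuantumFields.YangMills.Theorems.BalabanUVNodesN08HaarCompatibilityGuardJacobian

/-!
# BalabanUVNodes ∕ N08 — THE ENGINE'S WINDOW TOOLS: (E4, generic) A COERCIVE DERIVATIVE ON A CONVEX SET MAKES THE MAP INJECTIVE AND `c`-EXPANDING;
# COERCIVITY SURVIVES SMALL PERTURBATIONS; FINITE BALL COVERS; and (N = 2) THE HAAR-JACOBIAN FLOOR OF PART 21 FROM A PLAIN DETERMINANT FLOOR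

WIDTH SEAT `pub-ymgap-dag-n08-w3` g4, `W-SEAT-START-LIST.md` v10 §0 (iii); item-3 lineage part 22, 2026-08-28.  DAG node N08 = [Balaban1985UV3] Thm 1
p. 257 (compact) + Thm 2 p. 272; key item K1⁷ `StabilityBAtRecordR13SepCoPH` (stmt-QuantumFields-20542), `--supports … --as helper`.  COUNT-NEUTRAL.

THE POINT.  Part 21 (`…GuardChartTransfer.haar_map_le_of_windows`) reduces the fibre-law hypothesis (H_K) of part 20 at `N = 2` to chart WINDOWS on which the
chart conjugate `ψc` of the fibre map is INJECTIVE and differentiable with a Haar-Jacobian floor.  The floor is n08-w6's determinant form; injectivity on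
windows is (E4).  This file banks the generic calculus (E4) needs, on any real inner-product space:
 §1 `mul_norm_sq_le_inner_sub` ∕ `mul_norm_le_norm_sub` ∕ ★ `injOn_of_coercive`: if `f` is differentiable within a CONVEX `s` and its derivative is
    `c`-COERCIVE there (`c‖v‖² ≤ ⟪f′(z)v, v⟫`), then `c‖y − x‖² ≤ ⟪f y − f x, y − x⟫`, `c‖y − x‖ ≤ ‖f y − f x‖`, and for `c > 0` the map is injective on
    `s` (monotone-operator argument: the mean-value inequality `Convex.mul_sub_le_image_sub_of_le_deriv` along the segment);
 §2 `coercive_of_norm_sub_le`: coercivity is ROBUST — `‖f′(z) − T‖ ≤ ε` and `T` `c`-coercive ⟹ `f′(z)` `(c − ε)`-coercive (this is how pub-balaban's pointwise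
    coercivity of the trivialised tangent map (part 14 ∕ n08-w6) passes to chart coordinates on a small window, the chart distortion being the `ε`);
 §3 `exists_finset_cover_balls`: a totally bounded set (e.g. a subset of a closed ball of `ℝ³`) is covered by finitely many `r`-balls centred IN the set
    (`Metric.finite_approx_of_totallyBounded`) — the windows; balls are convex (`convex_ball`), so §1 applies on each;
 §4 `sigmaSU2_le_sigma0` ∕ `sigma0_mul_sq_le_sigmaSU2` ∕ ★ `haarJacobianFloor_of_det_floor`: on a window whose TARGET chart coordinates stay within radius
    `r₀ ≤ π`, a plain determinant floor `m₀ ≤ |det ψc′(A)|` gives part 21's Haar-Jacobian floor `m·σ(|A|) ≤ |det ψc′(A)|·σ(|ψc A|)` with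
    `m = m₀·(sin r₀∕r₀)²` (print's `σ_{SU(2)}(r) = σ₀·(sin r∕r)²` is at most `σ₀` and at least `σ₀(sin r₀∕r₀)²` for `r ≤ r₀ ≤ π`; monotonicity of `sin r∕r` =
    part 14's `sin_div_le_sin_div`).

HONEST FRAMING.  [folklore] calculus (§4: bookkeeping on print's chart weight); nothing of Bałaban's asserted; no fibre map is touched: (E3) (chain rule + chart-coercivity of the printed fibre map)
is NOT typed; (H_K) NOT discharged; E6′ NOT decided; `hmass` NOT supplied; count-neutral; N08 NOT discharged; counts unmoved (typed 28∕28 · discharged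
5∕27); one finite 𝕋⁴ programme at fixed ε — R4 closes the CONDITIONAL rung `BalabanLadder.UV` only; the Yang–Mills mass gap (Clay) is NOT proved;
nothing continuum ∕ OS.  0 `sorry`, 0 `def`, standard axioms.
-/

noncomputable section

open Set Metric Function
open scoped RealInnerProductSpace

namespace Summit.QuantumFields.YangMills.BalabanUVNodes.N08HaarCompatibilityGuardCoerciveWindows

/-! ## §1 [folklore] Coercive derivative on a convex set ⟹ expanding, injective -/

section Coercive

variable {V : Type*} [NormedAddCommGroup V] [InnerProductSpace ℝ V]

/-- Along the segment `t ↦ x + t(y − x)` inside a convex `s`, the pairing `t ↦ ⟪y − x, f(x + t(y − x))⟫` has derivative `⟪y − x, f′(·)(y − x)⟫`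
within `[0, 1]` (chain rule). [folklore] -/
theorem hasDerivWithinAt_inner_segment {f : V → V} {f' : V → V →L[ℝ] V} {s : Set V} (hs : Convex ℝ s)
    (hf : ∀ z ∈ s, HasFDerivWithinAt f (f' z) s z) {x y : V} (hx : x ∈ s) (hy : y ∈ s) {t : ℝ} (ht : t ∈ Icc (0 : ℝ) 1) :
    HasDerivWithinAt (fun t : ℝ => ⟪y - x, f (x + t • (y - x))⟫) ⟪y - x, f' (x + t • (y - x)) (y - x)⟫ (Icc (0 : ℝ) 1) t := by
  have hγ : HasDerivWithinAt (fun t : ℝ => x + t • (y - x)) (y - x) (Icc (0 : ℝ) 1) t := by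
    have h := ((hasDerivAt_id t).smul_const (y - x)).const_add x
    simp only [id, one_smul] at h
    exact h.hasDerivWithinAt
  have hmaps : MapsTo (fun t : ℝ => x + t • (y - x)) (Icc (0 : ℝ) 1) s := fun u hu => hs.add_smul_sub_mem hx hy hu
  have hcomp : HasDerivWithinAt (f ∘ fun t : ℝ => x + t • (y - x)) (f' (x + t • (y - x)) (y - x)) (Icc (0 : ℝ) 1) t :=
    (hf _ (hmaps ht)).comp_hasDerivWithinAt t hγ hmaps
  have h := (innerSL ℝ (y - x)).hasFDerivAt.comp_hasDerivWithinAt t hcomp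
  exact h

/-- **MONOTONE-OPERATOR INEQUALITY.**  `f` differentiable within a convex `s` with `c`-coercive derivative (`c‖v‖² ≤ ⟪f′(z)v, v⟫` for `z ∈ s`)
⟹ `c‖y − x‖² ≤ ⟪f y − f x, y − x⟫` for `x, y ∈ s`. [folklore] -/
theorem mul_norm_sq_le_inner_sub {f : V → V} {f' : V → V →L[ℝ] V} {s : Set V} (hs : Convex ℝ s)
    (hf : ∀ z ∈ s, HasFDerivWithinAt f (f' z) s z) {c : ℝ} (hc : ∀ z ∈ s, ∀ v, c * ‖v‖ ^ 2 ≤ ⟪f' z v, v⟫)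
    {x y : V} (hx : x ∈ s) (hy : y ∈ s) : c * ‖y - x‖ ^ 2 ≤ ⟪f y - f x, y - x⟫ := by
  set φ : ℝ → ℝ := fun t => ⟪y - x, f (x + t • (y - x))⟫ with hφ
  have hder : ∀ t ∈ Icc (0 : ℝ) 1, HasDerivWithinAt φ ⟪y - x, f' (x + t • (y - x)) (y - x)⟫ (Icc (0 : ℝ) 1) t :=
    fun t ht => hasDerivWithinAt_inner_segment hs hf hx hy ht
  have hcont : ContinuousOn φ (Icc (0 : ℝ) 1) := fun t ht => (hder t ht).continuousWithinAt
  have hat : ∀ t ∈ Ioo (0 : ℝ) 1, HasDerivAt φ ⟪y - x, f' (x + t • (y - x)) (y - x)⟫ t :=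
    fun t ht => (hder t (Ioo_subset_Icc_self ht)).hasDerivAt (Icc_mem_nhds ht.1 ht.2)
  have hdiff : DifferentiableOn ℝ φ (interior (Icc (0 : ℝ) 1)) := by
    rw [interior_Icc]
    exact fun t ht => (hat t ht).differentiableAt.differentiableWithinAt
  have hge : ∀ t ∈ interior (Icc (0 : ℝ) 1), c * ‖y - x‖ ^ 2 ≤ deriv φ t := by
    rw [interior_Icc]
    intro t ht
    rw [(hat t ht).deriv, real_inner_comm]
    exact hc _ (hs.add_smul_sub_mem hx hy (Ioo_subset_Icc_self ht)) _
  have h := Convex.mul_sub_le_image_sub_of_le_deriv (convex_Icc (0 : ℝ) 1) hcont hdiff hge 0 (left_mem_Icc.2 zero_le_one) 1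
    (right_mem_Icc.2 zero_le_one) zero_le_one
  have h1 : φ 1 = ⟪y - x, f y⟫ := by simp only [hφ, one_smul, add_sub_cancel]
  have h0 : φ 0 = ⟪y - x, f x⟫ := by simp only [hφ, zero_smul, add_zero]
  rw [sub_zero, mul_one, h1, h0, ← inner_sub_right, real_inner_comm] at h
  exact h

/-- **EXPANSION.**  Under the same hypotheses `c‖y − x‖ ≤ ‖f y − f x‖` (Cauchy–Schwarz). [folklore] -/
theorem mul_norm_le_norm_sub {f : V → V} {f' : V → V →L[ℝ] V} {s : Set V} (hs : Convex ℝ s)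
    (hf : ∀ z ∈ s, HasFDerivWithinAt f (f' z) s z) {c : ℝ} (hc : ∀ z ∈ s, ∀ v, c * ‖v‖ ^ 2 ≤ ⟪f' z v, v⟫)
    {x y : V} (hx : x ∈ s) (hy : y ∈ s) : c * ‖y - x‖ ≤ ‖f y - f x‖ := by
  have h := (mul_norm_sq_le_inner_sub hs hf hc hx hy).trans (real_inner_le_norm _ _)
  by_cases h0 : ‖y - x‖ = 0
  · rw [h0, mul_zero]
    exact norm_nonneg _
  · have hpos : 0 < ‖y - x‖ := lt_of_le_of_ne (norm_nonneg _) (Ne.symm h0)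
    rw [pow_two, ← mul_assoc] at h
    exact le_of_mul_le_mul_right h hpos

/-- ★ **INJECTIVITY FROM COERCIVITY.**  `f` differentiable within a convex `s` with `c`-coercive derivative, `c > 0` ⟹ `f` is injective on `s`. [folklore] -/
theorem injOn_of_coercive {f : V → V} {f' : V → V →L[ℝ] V} {s : Set V} (hs : Convex ℝ s)
    (hf : ∀ z ∈ s, HasFDerivWithinAt f (f' z) s z) {c : ℝ} (hc0 : 0 < c) (hc : ∀ z ∈ s, ∀ v, c * ‖v‖ ^ 2 ≤ ⟪f' z v, v⟫) :
    InjOn f s := by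
  intro x hx y hy hfxy
  have h := mul_norm_le_norm_sub hs hf hc hx hy
  rw [hfxy, sub_self, norm_zero] at h
  have h' : ‖y - x‖ ≤ 0 := by
    by_contra hlt
    push Not at hlt
    have := mul_pos hc0 hlt
    linarith
  exact (sub_eq_zero.1 (norm_le_zero_iff.1 h')).symm

end Coercive

/-! ## §2 [folklore] Coercivity is robust under small perturbations of the derivative -/

section Robust

variable {V : Type*} [NormedAddCommGroup V] [InnerProductSpace ℝ V]

/-- `T` `c`-coercive and `‖A − T‖ ≤ ε` ⟹ `A` `(c − ε)`-coercive: `(c − ε)‖v‖² ≤ ⟪A v, v⟫`. [folklore] -/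
theorem coercive_of_norm_sub_le {A T : V →L[ℝ] V} {c ε : ℝ} (hT : ∀ v, c * ‖v‖ ^ 2 ≤ ⟪T v, v⟫) (hA : ‖A - T‖ ≤ ε) (v : V) :
    (c - ε) * ‖v‖ ^ 2 ≤ ⟪A v, v⟫ := by
  have h1 : ⟪A v, v⟫ = ⟪T v, v⟫ + ⟪(A - T) v, v⟫ := by
    rw [show (A - T) v = A v - T v from rfl, inner_sub_left]
    ring
  have h2 : |⟪(A - T) v, v⟫| ≤ ε * ‖v‖ ^ 2 :=
    calc |⟪(A - T) v, v⟫| ≤ ‖(A - T) v‖ * ‖v‖ := abs_real_inner_le_norm _ _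
      _ ≤ ‖A - T‖ * ‖v‖ * ‖v‖ := mul_le_mul_of_nonneg_right ((A - T).le_opNorm v) (norm_nonneg _)
      _ ≤ ε * ‖v‖ * ‖v‖ := mul_le_mul_of_nonneg_right (mul_le_mul_of_nonneg_right hA (norm_nonneg _)) (norm_nonneg _)
      _ = ε * ‖v‖ ^ 2 := by ring
  have h3 := neg_abs_le ⟪(A - T) v, v⟫
  rw [h1]
  nlinarith [hT v]

/-- The same for a FAMILY of derivatives: pointwise `‖f′(z) − T z‖ ≤ ε` on `s` with every `T z` `c`-coercive ⟹ every `f′(z)` `(c − ε)`-coercive on `s`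
(the form §1 consumes). [folklore] -/
theorem coercive_family_of_norm_sub_le {f' T : V → V →L[ℝ] V} {s : Set V} {c ε : ℝ}
    (hT : ∀ z ∈ s, ∀ v, c * ‖v‖ ^ 2 ≤ ⟪T z v, v⟫) (hA : ∀ z ∈ s, ‖f' z - T z‖ ≤ ε) :
    ∀ z ∈ s, ∀ v, (c - ε) * ‖v‖ ^ 2 ≤ ⟪f' z v, v⟫ :=
  fun z hz v => coercive_of_norm_sub_le (hT z hz) (hA z hz) v

end Robust

/-! ## §3 [folklore] Finite ball covers (the windows) -/

section Cover

variable {X : Type*} [PseudoMetricSpace X]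

/-- A totally bounded set is covered by finitely many `r`-balls centred in the set. [folklore] -/
theorem exists_finset_cover_balls {s : Set X} (hs : TotallyBounded s) {r : ℝ} (hr : 0 < r) :
    ∃ T : Finset X, ↑T ⊆ s ∧ s ⊆ ⋃ y ∈ T, ball y r := by
  obtain ⟨t, hts, htf, hst⟩ := finite_approx_of_totallyBounded hs r hr
  refine ⟨htf.toFinset, by simpa using hts, ?_⟩
  intro x hx
  obtain ⟨y, hy, hxy⟩ := mem_iUnion₂.1 (hst hx)
  exact mem_iUnion₂.2 ⟨y, htf.mem_toFinset.2 hy, hxy⟩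

/-- In a proper space every subset of a closed ball is covered by finitely many `r`-balls centred in the set (compact closed balls are totally bounded).
[folklore] -/
theorem exists_finset_cover_balls_of_subset_closedBall [ProperSpace X] {s : Set X} {x₀ : X} {R : ℝ} (hs : s ⊆ closedBall x₀ R)
    {r : ℝ} (hr : 0 < r) : ∃ T : Finset X, ↑T ⊆ s ∧ s ⊆ ⋃ y ∈ T, ball y r :=
  exists_finset_cover_balls ((isCompact_closedBall x₀ R).totallyBounded.subset hs) hr

/-- The windows are convex: on each ball of the cover §1 applies (restated for the record: `convex_ball`). [folklore] -/
theorem convex_window {V : Type*} [NormedAddCommGroup V] [InnerProductSpace ℝ V] (y : V) (r : ℝ) : Convex ℝ (ball y r) :=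
  convex_ball y r

/-- ★ **WINDOWS FOR A COERCIVE MAP.**  If `f` is differentiable within each ball `ball y r`, `y ∈ T`, with `c`-coercive derivative there, `c > 0`,
then `f` is injective on EVERY window `ball y r ∩ S` (any `S`) — the form part 21's `haar_map_le_of_windows` consumes window by window. [folklore] -/
theorem injOn_windows {V : Type*} [NormedAddCommGroup V] [InnerProductSpace ℝ V] {f : V → V} {f' : V → V →L[ℝ] V}
    (T : Finset V) (r : ℝ) (hf : ∀ y ∈ T, ∀ z ∈ ball y r, HasFDerivWithinAt f (f' z) (ball y r) z) {c : ℝ} (hc0 : 0 < c)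
    (hc : ∀ y ∈ T, ∀ z ∈ ball y r, ∀ v, c * ‖v‖ ^ 2 ≤ ⟪f' z v, v⟫) (S : Set V) :
    ∀ y ∈ T, InjOn f (ball y r ∩ S) :=
  fun y hy => (injOn_of_coercive (convex_ball y r) (hf y hy) hc0 (hc y hy)).mono inter_subset_left

end Cover

/-! ## §4 The Haar-Jacobian floor on a small window from a plain determinant floor (`N = 2`) -/

section Floor

open scoped ENNReal
open Literature.MathematicalPhysics.QuantumFieldTheory.Balaban1983to89.B10Eq22Rescaling (sigmaSU2)
open Summit.QuantumFields.YangMills.BalabanUVNodes.N08HaarCompatibilityGuardJacobian (sin_div_le_sin_div sin_div_le_one)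

/-- Print's `σ_{SU(2)}(r) = σ₀·(sin r∕r)²` is at most `σ₀ = 1∕2π²`. [cite: Balaban1985UV3, p. 260 (bookkeeping)] -/
theorem sigmaSU2_le_sigma0 (r : ℝ) : sigmaSU2 r ≤ 1 / (2 * Real.pi ^ 2) := by
  unfold sigmaSU2
  have h1 : (if r = 0 then (1 : ℝ) else Real.sin r / r) ^ 2 ≤ 1 := by
    split_ifs with hr
    · norm_num
    · have hle : |Real.sin r / r| ≤ 1 := by
        rw [abs_div, div_le_one (abs_pos.2 hr)]
        exact Real.abs_sin_le_abs
      have hsq : (Real.sin r / r) ^ 2 = |Real.sin r / r| ^ 2 := (sq_abs _).symm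
      rw [hsq]
      exact pow_le_one₀ (abs_nonneg _) hle
  have h0 : 0 ≤ 1 / (2 * Real.pi ^ 2) := by positivity
  calc 1 / (2 * Real.pi ^ 2) * (if r = 0 then (1 : ℝ) else Real.sin r / r) ^ 2 ≤ 1 / (2 * Real.pi ^ 2) * 1 :=
      mul_le_mul_of_nonneg_left h1 h0
    _ = 1 / (2 * Real.pi ^ 2) := mul_one _

/-- … and at least `σ₀·(sin r₀∕r₀)²` for `0 ≤ r ≤ r₀ ≤ π`, `0 < r₀` (`sin r∕r` decreases on `[0, π]`, part 14 `sin_div_le_sin_div`).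
[cite: Balaban1985UV3, p. 260 (bookkeeping)] -/
theorem sigma0_mul_sq_le_sigmaSU2 {r r₀ : ℝ} (hr : 0 ≤ r) (hrr₀ : r ≤ r₀) (hr₀ : 0 < r₀) (hr₀π : r₀ ≤ Real.pi) :
    1 / (2 * Real.pi ^ 2) * (Real.sin r₀ / r₀) ^ 2 ≤ sigmaSU2 r := by
  unfold sigmaSU2
  have hs0 : 0 ≤ Real.sin r₀ / r₀ := div_nonneg (Real.sin_nonneg_of_nonneg_of_le_pi hr₀.le hr₀π) hr₀.le
  have h1 : Real.sin r₀ / r₀ ≤ (if r = 0 then (1 : ℝ) else Real.sin r / r) := by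
    split_ifs with h
    · exact sin_div_le_one hr₀
    · exact sin_div_le_sin_div (lt_of_le_of_ne hr (Ne.symm h)) hrr₀ hr₀π
  have h0 : 0 ≤ 1 / (2 * Real.pi ^ 2) := by positivity
  exact mul_le_mul_of_nonneg_left (pow_le_pow_left₀ hs0 h1 2) h0

/-- ★ **THE HAAR-JACOBIAN FLOOR FROM A DETERMINANT FLOOR ON A SMALL WINDOW.**  If the target chart coordinates stay within radius `r₀ ≤ π`
(`‖ψc A‖ ≤ r₀` on `W`) and `m₀ ≤ |det ψc′(A)|` on `W` (`m₀ ≥ 0`), then part 21's hypothesis holds with `m = m₀·(sin r₀∕r₀)²`: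
`m·σ(|A|) ≤ |det ψc′(A)|·σ(|ψc A|)` on `W`. [cite: Balaban1985UV3, p. 260 (the chart weight; bookkeeping)] -/
theorem haarJacobianFloor_of_det_floor {W : Set (EuclideanSpace ℝ (Fin 3))} {ψc : EuclideanSpace ℝ (Fin 3) → EuclideanSpace ℝ (Fin 3)}
    {ψc' : EuclideanSpace ℝ (Fin 3) → EuclideanSpace ℝ (Fin 3) →L[ℝ] EuclideanSpace ℝ (Fin 3)} {r₀ m₀ : ℝ} (hr₀ : 0 < r₀)
    (hr₀π : r₀ ≤ Real.pi) (hm₀ : 0 ≤ m₀) (htgt : ∀ x ∈ W, ‖ψc x‖ ≤ r₀) (hdet : ∀ x ∈ W, m₀ ≤ |(ψc' x).det|) :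
    ∀ x ∈ W, ENNReal.ofReal (m₀ * (Real.sin r₀ / r₀) ^ 2) * ENNReal.ofReal (sigmaSU2 ‖x‖) ≤
      ENNReal.ofReal |(ψc' x).det| * ENNReal.ofReal (sigmaSU2 ‖ψc x‖) := by
  intro x hx
  rw [← ENNReal.ofReal_mul (by positivity), ← ENNReal.ofReal_mul (abs_nonneg _)]
  refine ENNReal.ofReal_le_ofReal ?_
  calc m₀ * (Real.sin r₀ / r₀) ^ 2 * sigmaSU2 ‖x‖ ≤ m₀ * (Real.sin r₀ / r₀) ^ 2 * (1 / (2 * Real.pi ^ 2)) :=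
      mul_le_mul_of_nonneg_left (sigmaSU2_le_sigma0 _) (by positivity)
    _ = m₀ * (1 / (2 * Real.pi ^ 2) * (Real.sin r₀ / r₀) ^ 2) := by ring
    _ ≤ |(ψc' x).det| * sigmaSU2 ‖ψc x‖ :=
      mul_le_mul (hdet x hx) (sigma0_mul_sq_le_sigmaSU2 (norm_nonneg _) (htgt x hx) hr₀ hr₀π) (by positivity) (abs_nonneg _)

end Floor

end Summit.QuantumFields.YangMills.BalabanUVNodes.N08HaarCompatibilityGuardCoerciveWindows

end
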